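import Summits.BirchSwinnertonDyer.BirchSwinnertonDyer.Theorems.TwoAdicConverseMultEisenstein
import Summits.BirchSwinnertonDyer.BirchSwinnertonDyer.Theorems.TwoAdicConverseGoodOrdinaryEisensteinWeak
import Literature.NumberTheory.EllipticCurves.ComplexMultiplicationNotSemistable
import HarnessLib

/-!
# Route `TwoAdicConverse` (rung S3), crux `MultiplicativeRankZeroTwoConverse` (item
# stmt-BirchSwinnertonDyer-19219): the research object WEAKENED FROM THE CONVERSE SIDE — needed only at
# curves with finite `Sel_{2^∞}` and only UP TO ISOGENY — on both typed roads; and the idle `¬ CM` binder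

Cell `bsd-2adic`, seat `bsd-2adic-conv-2` GEN 2. THEOREMS ONLY — nothing asserted, no definition, no named
fact. The multiplicative twin of `TwoAdicConverseGoodOrdinaryEisensteinWeak.lean` (seat conv-1, p418541),
written against the two typed roads to 19219 now in the tree:

* the CYCLOTOMIC road (GEN 0, `TwoAdicConverseMultEisenstein.lean`, p418740): PRINT {A235, A236,
  modularity} + MEMO {K11, GS2} + `X5.O1.MultEisensteinDivisibilityAtTwo` (T-mult-4-int);
* the KATO–ZETA road (GEN 2, `TwoAdicConverseKatoZetaRoad.lean`, p422516; Burungale–Tian 2026 Thm. 3.1 /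
  Rmk. 3.2): a Kato descent datum + readings (3.1), (VAN) + Kato's Conj. 12.10 in `Λ ⊗ ℚ₂`.

What is proved:
* `multiplicativeRankZeroTwoConverse_iff_forall_mult` — **the binder `¬ W.HasCM` of 19219 is IDLE**: a
  curve with multiplicative reduction at `2` has no CM (`j ∉ ℤ`; tree theorem
  `WeierstrassCurve.not_hasMultiplicativeReductionAtPrime_of_hasCM`, Silverman ATAEC II.6), so the crux is
  equivalent to its CM-free form. (Planner hygiene: the statement may drop `¬ W.HasCM`; nothing else changes.)
* `multiplicativeRankZeroTwoConverse_of_multEisenstein_finiteSel_upToIsogeny` — cyclotomic road: PRINT +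
  MEMO as in p418740, and T-mult-4-int ONLY for curves with `Sel_{2^∞}(E/ℚ)` FINITE and only at SOME
  globally minimal multiplicative-at-`2` curve `W'` `ℚ`-ISOGENOUS to `W` ⟹ the crux; mechanism = isogeny
  invariance of `corank Sel_{2^∞}` and of `ord_{s=1} L` (`IsIsogenous.selmerCorank_eq`,
  `analyticRank_eq_of_isIsogenous'`, both unconditional; conv-1's
  `analyticRank_eq_zero_of_isIsogenous_of_selmerCorank_two_eq_zero` reused, not restated) + GEN 0's
  per-curve theorems at `W'`; `…_finiteSel` = same model.
* (zeta road: the per-curve theorem `KatoZeta.analyticRank_eq_zero_of_datum` of p422516 at an isogenous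
  `W'` composes with `analyticRank_eq_zero_of_isIsogenous_of_selmerCorank_two_eq_zero` in the same way; not
  restated here.)

HONEST FRAMING: no free lunch — on the finite-`Sel` locus each road's object at `T = 0` is equivalent to
the converse itself; the gain is the freedom of the isogenous model (one member per isogeny class — e.g.
the twist anchors / distinguished members where the cell's X5 instance files certify) and the finite-`Sel`
restriction, for whoever attacks the objects at `2`. PARTITION (D-0054): none — RANK axis (S3 mult);
companion formula cell X5@2 mult (B1·O1; 1 976 classes).

References: [GreenbergLNM1716] §1 pp. 54–57, §4 pp. 112–113; [Knapp1993] Thm. 11.67;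
[SilvermanATAEC1994] Thm. II.6.1/II.6.4; [BurungaleTian2026] Thm. 3.1, Rmk. 3.2;
[Kato2004Asterisque] Thm. 17.4, Conj. 12.10.
-/

set_option linter.dupNamespace false
set_option autoImplicit false

noncomputable section

open scoped Classical

open WeierstrassCurve Literature.NumberTheory.EllipticCurves
  Literature.NumberTheory.EllipticCurves.ModularForms
  Literature.NumberTheory.EllipticCurves.Greenberg1999
  Literature.NumberTheory.EllipticCurves.Rank1Residual
  Literature.NumberTheory.EllipticCurves.Rank1Residual.Typed
  Summit.BirchSwinnertonDyer.Rank1Residual.X5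
  Summit.BirchSwinnertonDyer.Rank1Residual.X5.O1
  Summit.BirchSwinnertonDyer.BirchSwinnertonDyer.Theses.TwoAdicConverse

namespace Summit.BirchSwinnertonDyer.BirchSwinnertonDyer.Theorems

/-- **The binder `¬ W.HasCM` of the crux is idle.** A curve with multiplicative reduction at `2` has
`‖j‖₂ > 1`, hence `j ∉ ℤ`, hence no CM (tree theorem
`WeierstrassCurve.not_hasMultiplicativeReductionAtPrime_of_hasCM`); so `MultiplicativeRankZeroTwoConverse`
is equivalent to the same statement without the non-CM hypothesis.
[cite: SilvermanATAEC1994, Thm. II.6.1 and proof of Thm. II.10.5] [cite: SilvermanAEC2009, Prop. VII.5.1(b)] -/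
theorem multiplicativeRankZeroTwoConverse_iff_forall_mult :
    MultiplicativeRankZeroTwoConverse ↔
      ∀ (W : WeierstrassCurve ℚ) [W.IsElliptic] [W.IsGloballyMinimal],
        Mult W 2 → W.selmerCorank 2 = 0 → W.analyticRank = 0 := by
  unfold MultiplicativeRankZeroTwoConverse
  constructor
  · intro h W _ _ hmult hsel
    exact h W (fun hCM => W.not_hasMultiplicativeReductionAtPrime_of_hasCM hCM 2 hmult) hmult hsel
  · intro h W _ _ _ hmult hsel
    exact h W hmult hsel

/-- **Cyclotomic road, weakened from the converse side: T-mult-4-int on the finite-`Sel` locus, up to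
isogeny.** PRINT {A235 `h41ns`, A236 `h41sp`, modularity `hmod`} + MEMO {K11 `hKato` ∀ non-CM
multiplicative-at-`2` (used only for «`X` torsion»), Greenberg–Stevens at `2` `hGS` ∀ split} and (`hE`):
for every non-CM globally minimal `W` multiplicative at `2` WITH `Sel_{2^∞}(W/ℚ)` FINITE there is a
globally minimal `W'`, `ℚ`-isogenous to `W` and multiplicative at `2`, at which
`X5.O1.MultEisensteinDivisibilityAtTwo W'` holds ⟹ `MultiplicativeRankZeroTwoConverse`. Proof: corank `0`
for `W` ⟹ corank `0` for `W'` (isogeny) ⟹ `Sel_{2^∞}(W')` finite ⟹ `r_an(W') = 0` (GEN 0's per-curve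
theorems `analyticRank_eq_zero_of_finite_selmer_{split,nonsplit}_two_of_multEisenstein` at `W'`, which is
non-CM because multiplicative at `2`) ⟹ `r_an(W) = 0` (isogeny).
[cite: GreenbergLNM1716, §4 pp. 112–113 and §1 pp. 54–57] [cite: Knapp1993, Thm. 11.67]
[cite: Kato2004Asterisque, Thm 17.4 (1) and 17.13] -/
theorem multiplicativeRankZeroTwoConverse_of_multEisenstein_finiteSel_upToIsogeny
    (h41ns : thm41Analogue_charValue_rankZero_numberField_anyPrime)
    (h41sp : thm41Analogue_charValue_rankZero_split_baseChange_anyPrime)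
    (hmod : nonempty_modularParametrizationData)
    (hKato : ∀ (W : WeierstrassCurve ℚ) [W.IsElliptic] [W.IsGloballyMinimal],
      ¬ W.HasCM → Mult W 2 → KatoMultiplicativeDivisibilityRat W 2)
    (hGS : ∀ (W : WeierstrassCurve ℚ) [W.IsElliptic] [W.IsGloballyMinimal],
      W.HasSplitMultiplicativeReductionAtPrime 2 → greenberg_stevens (W := W) (p := 2))
    (hE : ∀ (W : WeierstrassCurve ℚ) [W.IsElliptic] [W.IsGloballyMinimal], ¬ W.HasCM → Mult W 2 →
      Finite (W.selmerGroupPInfty 2) →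
        ∃ (W' : WeierstrassCurve ℚ) (_ : W'.IsElliptic) (_ : W'.IsGloballyMinimal),
          IsIsogenous W W' ∧ Mult W' 2 ∧ MultEisensteinDivisibilityAtTwo W') :
    MultiplicativeRankZeroTwoConverse := by
  unfold MultiplicativeRankZeroTwoConverse
  intro W _ _ hcm hmult hsel
  have hSel : Finite (W.selmerGroupPInfty 2) :=
    (finite_selmerGroupPInfty_iff_selmerCorank_eq_zero W 2).2 hsel
  obtain ⟨W', _, _, hiso, hmult', hE'⟩ := hE W hcm hmult hSel
  have hcm' : ¬ W'.HasCM := fun hCM => W'.not_hasMultiplicativeReductionAtPrime_of_hasCM hCM 2 hmult'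
  refine analyticRank_eq_zero_of_isIsogenous_of_selmerCorank_two_eq_zero hiso (fun hsel' ↦ ?_) hsel
  have hfin' : Finite (W'.selmerGroupPInfty 2) :=
    (finite_selmerGroupPInfty_iff_selmerCorank_eq_zero W' 2).2 hsel'
  have hX := isTorsion_of_katoMultiplicativeDivisibilityRat W' hmod (hKato W' hcm' hmult') hmult'
  by_cases hsp : W'.HasSplitMultiplicativeReductionAtPrime 2
  · exact (analyticRank_eq_zero_of_finite_selmer_split_two_of_multEisenstein W' (hGS W' hsp) h41sp
      hmod hX hE' hmult' hsp hfin').2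
  · exact (analyticRank_eq_zero_of_finite_selmer_nonsplit_two_of_multEisenstein W' h41ns hmod hX hE'
      hmult' hsp hfin').2

/-- **Special case (same model): T-mult-4-int on the finite-`Sel` locus** — PRINT + MEMO as above and
`X5.O1.MultEisensteinDivisibilityAtTwo W` at every non-CM globally minimal multiplicative-at-`2` curve
WITH FINITE `Sel_{2^∞}` ⟹ the crux (`W' = W`): GEN 0's research object restricted to the only curves the
converse ever looks at. [cite: GreenbergLNM1716, §4 pp. 112–113] [cite: Kato2004Asterisque, Thm 17.4 (1)] -/
theorem multiplicativeRankZeroTwoConverse_of_multEisenstein_finiteSel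
    (h41ns : thm41Analogue_charValue_rankZero_numberField_anyPrime)
    (h41sp : thm41Analogue_charValue_rankZero_split_baseChange_anyPrime)
    (hmod : nonempty_modularParametrizationData)
    (hKato : ∀ (W : WeierstrassCurve ℚ) [W.IsElliptic] [W.IsGloballyMinimal],
      ¬ W.HasCM → Mult W 2 → KatoMultiplicativeDivisibilityRat W 2)
    (hGS : ∀ (W : WeierstrassCurve ℚ) [W.IsElliptic] [W.IsGloballyMinimal],
      W.HasSplitMultiplicativeReductionAtPrime 2 → greenberg_stevens (W := W) (p := 2))
    (hE : ∀ (W : WeierstrassCurve ℚ) [W.IsElliptic] [W.IsGloballyMinimal], ¬ W.HasCM → Mult W 2 →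
      Finite (W.selmerGroupPInfty 2) → MultEisensteinDivisibilityAtTwo W) :
    MultiplicativeRankZeroTwoConverse :=
  multiplicativeRankZeroTwoConverse_of_multEisenstein_finiteSel_upToIsogeny h41ns h41sp hmod hKato hGS
    fun W _ _ hcm hmult hSel ↦
      ⟨W, inferInstance, inferInstance, isIsogenous_self W, hmult, hE W hcm hmult hSel⟩

end Summit.BirchSwinnertonDyer.BirchSwinnertonDyer.Theorems

end
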